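import Summits.HubbardSuperconductivity.HubbardSuperconductivity.Theorems.NodalWardXYPerturbedXYOrderTwistEvenResponse
import Summits.HubbardSuperconductivity.HubbardSuperconductivity.Theorems.NodalWardXYPerturbedXYOrderTwistBound

/-!
# `PerturbedXYOrder` (stmt-HubbardSuperconductivity-10739) — line `schwarz-inheritance`, stub `stub_twistCertificateBound`

**Twist decoupling of admissible two-current tilts, II: pinching certificates are void.**

Lead c19 refuted two O(2)-INVARIANT long-range variants of the crux by GOLDSTONE PINCHING
(`perturbedXYOrder_false_for_invariant_meanField_source`, p156901; `perturbedXYOrder_false_for_invariant_relBounded_source`,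
p158891): for a real source `S` with `Z(s) = ∫_cube w_J e^{sS}`, the even entire function `G(s) = Z(s)Z(−s)/Z_0²` obeys
`log ‖G(σ)‖ ≤ C L³ σ²/ε` if it is zero-free on the `ε`-disc (second-order Borel–Carathéodory), while from below
`log G(σ) ≥ σ⟨S⟩_J + [−σ ⟨½(S∘τ_g + S∘τ_{−g})⟩_J − J Σ_b (1 − cos ∇_b g)]` (Jensen at `+σ`, the twisted Gibbs variational bound
`gp_twisted_jensen_symm` at `−σ`), and for those sources a cheap axial twist `g` moves `⟨S⟩` by `O(L³)` — a cusp at `σ = 0`.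

This file shows that the same certificate is EMPTY on the crux's own class.  By the pointwise twist-response bound
`‖½(W_K(θ+g) + W_K(θ−g)) − W_K(θ)‖ ≤ 288 ε Σ_b (1 − cos ∇_b g)` (`stub_twistEvenResponse`, p160907), for every kernel `K`
admissible at radius `ε`, every `σ ≥ 0`, every real `J` and EVERY site-dependent rotation `g`,

  `σ (⟨Re W_K⟩_J − ⟨½(Re W_K∘τ_g + Re W_K∘τ_{−g})⟩_J) − J Σ_b (1 − cos ∇_b g) ≤ (288 ε σ − J) Σ_b (1 − cos ∇_b g)`,

which is `≤ 0` once `J ≥ 288 ε σ` (`tcb_certificate_nonpos`): the gain from any twist is at most `288εσ/J ×` its cost.  So the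
infrared mechanism that kills the invariant mean-field / Ward sources cannot touch an admissible two-CURRENT tilt — the positive
shadow recorded on paper in `Cruxes/PerturbedXYOrder/HANDBACK-c19.md` §2, now kernel-checked for all twists (not only the axial family).
It does not prove zero-freeness (that is the engine stub `stub_tiltedCorrelationBounds`); it certifies which structure of `W_K` an engine
must exploit.
-/

noncomputable section

namespace Summit.HubbardSuperconductivity.HubbardSuperconductivity.Theorems.PerturbedXYOrder

open MeasureTheory Literature.Probability.LatticeModels
open Summit.HubbardSuperconductivity.HubbardSuperconductivity.Theses.NodalWardXY

variable {L : ℕ}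

/-! ### Pointwise and in the rotator state -/

/-- The real part of the symmetrised twist response. -/
theorem tcb_re_symm_sub [NeZero L] (K : Bond L → Bond L → ℂ) (θ g : TorusSite 3 L → ℝ) :
    ((Wk K (θ + g) + Wk K (θ - g)) / 2 - Wk K θ).re =
      ((Wk K (θ + g)).re + (Wk K (θ - g)).re) / 2 - (Wk K θ).re := by
  simp only [Complex.sub_re, Complex.add_re, Complex.div_ofNat_re]

/-- Pointwise: the tilt exceeds its symmetrised twist by at most `288 ε Σ_b (1 − cos ∇_b g)` (real parts). -/
theorem tcb_pointwise [NeZero L] {ε : ℝ} {K : Bond L → Bond L → ℂ} (hK : Admissible L ε K)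
    (θ g : TorusSite 3 L → ℝ) :
    (Wk K θ).re - ((Wk K (θ + g)).re + (Wk K (θ - g)).re) / 2 ≤
      288 * ε * ∑ b : Bond L, (1 - Real.cos (g (b.1 + Pi.single b.2 1) - g b.1)) := by
  have h := stub_twistEvenResponse L ε K hK θ g
  have hre := tcb_re_symm_sub K θ g
  have h1 : -(((Wk K (θ + g) + Wk K (θ - g)) / 2 - Wk K θ).re) ≤
      ‖(Wk K (θ + g) + Wk K (θ - g)) / 2 - Wk K θ‖ :=
    (neg_le_abs _).trans (Complex.abs_re_le_norm _)
  linarith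

/-- The real part of the tilt is continuous in the configuration. -/
theorem tcb_continuous_re_Wk [NeZero L] (K : Bond L → Bond L → ℂ) :
    Continuous fun θ : TorusSite 3 L → ℝ => (Wk K θ).re :=
  Complex.continuous_re.comp (ent_continuous_Wk K)

/-- The real part of the twisted tilt `θ ↦ Re W_K(θ + g)` is continuous. -/
theorem tcb_continuous_re_Wk_add [NeZero L] (K : Bond L → Bond L → ℂ) (g : TorusSite 3 L → ℝ) :
    Continuous fun θ : TorusSite 3 L → ℝ => (Wk K (θ + g)).re :=
  Complex.continuous_re.comp ((ent_continuous_Wk K).comp (continuous_id.add continuous_const))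

/-- The real part of the twisted tilt `θ ↦ Re W_K(θ − g)` is continuous. -/
theorem tcb_continuous_re_Wk_sub [NeZero L] (K : Bond L → Bond L → ℂ) (g : TorusSite 3 L → ℝ) :
    Continuous fun θ : TorusSite 3 L → ℝ => (Wk K (θ - g)).re :=
  Complex.continuous_re.comp ((ent_continuous_Wk K).comp (continuous_id.sub continuous_const))

/-- **Rotator expectations**: the tilt exceeds its symmetrised twist by at most `288 ε Σ_b (1 − cos ∇_b g)` in the state
`⟨F⟩_J = ∫ F w_J / ∫ w_J`. -/
theorem tcb_expect_sub_le [NeZero L] (J : ℝ) {ε : ℝ} {K : Bond L → Bond L → ℂ} (hK : Admissible L ε K)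
    (g : TorusSite 3 L → ℝ) :
    (∫ θ in cube L, (Wk K θ).re * (wJ J θ).re) / (∫ θ in cube L, (wJ J θ).re) -
        (∫ θ in cube L, ((Wk K (θ + g)).re + (Wk K (θ - g)).re) / 2 * (wJ J θ).re) / (∫ θ in cube L, (wJ J θ).re) ≤
      288 * ε * ∑ b : Bond L, (1 - Real.cos (g (b.1 + Pi.single b.2 1) - g b.1)) := by
  set C : ℝ := 288 * ε * ∑ b : Bond L, (1 - Real.cos (g (b.1 + Pi.single b.2 1) - g b.1)) with hC
  have hwc : Continuous fun θ : TorusSite 3 L → ℝ => (wJ J θ).re := gp_continuous_wJ_re J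
  have hZ : 0 < ∫ θ in cube L, (wJ J θ).re := gp_integral_wJ_re_pos J
  set f : (TorusSite 3 L → ℝ) → ℝ := fun θ => (Wk K θ).re * (wJ J θ).re with hf
  set s : (TorusSite 3 L → ℝ) → ℝ := fun θ => ((Wk K (θ + g)).re + (Wk K (θ - g)).re) / 2 * (wJ J θ).re with hs
  have hfc : Continuous f := (tcb_continuous_re_Wk K).mul hwc
  have hsc : Continuous s :=
    (((tcb_continuous_re_Wk_add K g).add (tcb_continuous_re_Wk_sub K g)).div_const 2).mul hwc
  have hfi := gp_integrable (L := L) hfc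
  have hsi := gp_integrable (L := L) hsc
  have hwi := gp_integrable (L := L) hwc
  have hsub : (∫ θ in cube L, f θ) - (∫ θ in cube L, s θ) = ∫ θ in cube L, (f θ - s θ) :=
    (integral_sub hfi hsi).symm
  have hmono : ∫ θ in cube L, (f θ - s θ) ≤ ∫ θ in cube L, C * (wJ J θ).re := by
    refine integral_mono (hfi.sub hsi) (hwi.const_mul C) fun θ => ?_
    have hp := tcb_pointwise hK θ g
    have hw := (gp_wJ_re_pos J θ).le
    show f θ - s θ ≤ C * (wJ J θ).re
    rw [hf, hs, hC]
    nlinarith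
  rw [integral_const_mul] at hmono
  rw [← sub_div, div_le_iff₀ hZ]
  show (∫ θ in cube L, f θ) - (∫ θ in cube L, s θ) ≤ C * ∫ θ in cube L, (wJ J θ).re
  rw [hsub]
  exact hmono

/-! ### The certificate bound -/

/-- STUB `stub_twistCertificateBound` (registered on stmt-HubbardSuperconductivity-10739, line `schwarz-inheritance`, skeleton rev 22,
lead c20): **twisted-Jensen pinching certificates are void on the admissible class.**  For every real `J`, `σ ≥ 0`, every
kernel `K` admissible at radius `ε` and EVERY site-dependent rotation `g`, the two-sided functional
`σ (⟨Re W_K⟩_J − ⟨½(Re W_K∘τ_g + Re W_K∘τ_{−g})⟩_J) − J Σ_b (1 − cos ∇_b g)` is at most `(288 ε σ − J) Σ_b (1 − cos ∇_b g)`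
(`stub_twistEvenResponse` integrated against the rotator state `w_J dθ / ∫ w_J`).  In the Goldstone-pinching refutations of the
invariant long-range sources `S = |M|²/L³` (p156901) and `S = R/L³` (p158891) this functional — Jensen at `+σ` plus the twisted Gibbs
variational bound at `−σ` — is what bounds `log (Z(σ)Z(−σ)/Z_0²)` from BELOW by `σ a₀ L³/2 − O(JL)`; on an admissible two-current tilt
it is `≤ 0` for all twists as soon as `J ≥ 288 ε σ` (`tcb_certificate_nonpos`), so no cusp at `σ = 0` can be certified this way:
the gradient structure of `W_K` decouples it from the Goldstone twists. [folklore] -/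
theorem stub_twistCertificateBound : ∀ (J : ℝ) (L : ℕ) [NeZero L] (ε σ : ℝ), 0 ≤ σ →
    ∀ (K : Bond L → Bond L → ℂ), Admissible L ε K → ∀ g : TorusSite 3 L → ℝ,
      σ * ((∫ θ in cube L, (Wk K θ).re * (wJ J θ).re) / (∫ θ in cube L, (wJ J θ).re) -
          (∫ θ in cube L, ((Wk K (θ + g)).re + (Wk K (θ - g)).re) / 2 * (wJ J θ).re) / (∫ θ in cube L, (wJ J θ).re)) -
        J * ∑ b : Bond L, (1 - Real.cos (g (b.1 + Pi.single b.2 1) - g b.1)) ≤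
      (288 * ε * σ - J) * ∑ b : Bond L, (1 - Real.cos (g (b.1 + Pi.single b.2 1) - g b.1)) := by
  intro J L _ ε σ hσ K hK g
  have h := tcb_expect_sub_le (L := L) J hK g
  have hmul := mul_le_mul_of_nonneg_left h hσ
  nlinarith

/-- **Void pinching certificates.** If `288 ε σ ≤ J` the two-sided twisted-Jensen functional is `≤ 0` for every twist `g`. -/
theorem tcb_certificate_nonpos [NeZero L] {J ε σ : ℝ} (hσ : 0 ≤ σ) (hJ : 288 * ε * σ ≤ J)
    {K : Bond L → Bond L → ℂ} (hK : Admissible L ε K) (g : TorusSite 3 L → ℝ) :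
    σ * ((∫ θ in cube L, (Wk K θ).re * (wJ J θ).re) / (∫ θ in cube L, (wJ J θ).re) -
          (∫ θ in cube L, ((Wk K (θ + g)).re + (Wk K (θ - g)).re) / 2 * (wJ J θ).re) / (∫ θ in cube L, (wJ J θ).re)) -
        J * ∑ b : Bond L, (1 - Real.cos (g (b.1 + Pi.single b.2 1) - g b.1)) ≤ 0 := by
  have h := stub_twistCertificateBound J L ε σ hσ K hK g
  have hcost : 0 ≤ ∑ b : Bond L, (1 - Real.cos (g (b.1 + Pi.single b.2 1) - g b.1)) :=
    Finset.sum_nonneg fun b _ => sub_nonneg.2 (Real.cos_le_one _)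
  have : (288 * ε * σ - J) * ∑ b : Bond L, (1 - Real.cos (g (b.1 + Pi.single b.2 1) - g b.1)) ≤ 0 :=
    mul_nonpos_of_nonpos_of_nonneg (by linarith) hcost
  linarith

end Summit.HubbardSuperconductivity.HubbardSuperconductivity.Theorems.PerturbedXYOrder

end
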